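import Summits.QuantumAdvantage.QuantumAdvantage.Theorems.SymplecticPurityDeqThesisCoreRealFourier
import Summits.QuantumAdvantage.QuantumAdvantage.Theorems.SymplecticPurityDeqThesisGoldWalsh

/-!
# Crux `DeqThesis`, line `Sketch` — real-tilt core, file 4/4: assembly (`stub_coreFlatRealSelfDual`)

`‖⟨ĝ|⊗R|ĝ⟩‖ ≤ 2^{-n}(2√2ⁿ + √2^{|in|}·√(8√2ⁿ κⁿ)) ≤ 2·0.7072ⁿ + 3·0.925ⁿ ≤ 0.933ⁿ ≤ 2^{-n/10}` for `n ≥ 200`,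
`κ = (1+√2)/2`. The registered sub-goal `stub_coreFlatRealSelfDual` (crux stmt-QuantumAdvantage-0242, line Sketch) is
the provable slice of the open core stub `stub_coreFlat`: all supports, REAL tilts, trace-orthonormal coordinates
(Lines/Sketch.md §3; the power-basis coordinates of the witness family and complex tilts remain open).
-/

set_option linter.dupNamespace false -- D-0017: single-problem summit ⇒ `QuantumAdvantage.QuantumAdvantage` by design

noncomputable section

namespace Summit.QuantumAdvantage.QuantumAdvantage.Theorems.SymplecticPurity

open Matrix Finset
open Literature.Computability.QuantumComplexity Literature.Computability.Cryptography

namespace CoreReal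

variable {n : ℕ}

section Statements

variable {K : Type} [Field K] [Fintype K] [Algebra (ZMod 2) K]

/-! ### Assembly -/

omit [Fintype K] [Algebra (ZMod 2) K] in
/-- The registered normalised vector is a constant multiple of the graph vector. -/
theorem normalised_eq_smul (e : K ≃+ (Fin n → ZMod 2)) :
    (fun w : QReg (n + n) =>
      if (fun j : Fin n => w (Fin.natAdd n j)) =
          (fun j : Fin n => decide (e ((e.symm (fun i : Fin n => if w (Fin.castAdd n i) then 1 else 0)) ^ 3) j = 1))
      then ((Real.sqrt 2 ^ n)⁻¹ : ℂ) else 0) = ((Real.sqrt 2 : ℂ) ^ n)⁻¹ • graphVec e := by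
  have hg : ∀ w : QReg (n + n), graphVec e w =
      if ((fun j : Fin n => w (Fin.natAdd n j)) =
          fun j => decide (e ((e.symm (fun i : Fin n => if w (Fin.castAdd n i) then 1 else 0)) ^ 3) j = 1))
      then (1 : ℂ) else 0 := fun w => rfl
  funext w
  rw [Pi.smul_apply, hg]
  split_ifs <;> simp

omit [Fintype K] [Algebra (ZMod 2) K] in
/-- Scaling a vector scales the quadratic form by `|λ|²`. -/
theorem star_smul_dot_mulVec_smul (M : Matrix (QReg (n + n)) (QReg (n + n)) ℂ) (v : QReg (n + n) → ℂ) (r : ℝ) :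
    star (((r : ℂ)) • v) ⬝ᵥ M *ᵥ (((r : ℂ)) • v) = ((r ^ 2 : ℝ) : ℂ) * (star v ⬝ᵥ M *ᵥ v) := by
  rw [Matrix.mulVec_smul, dotProduct_smul, star_smul, smul_dotProduct]
  simp only [smul_eq_mul, Complex.star_def, Complex.conj_ofReal]
  push_cast
  ring

omit [Fintype K] [Algebra (ZMod 2) K] in
/-- Numeric envelope: for `n ≥ 200`, `2·(0.7072)ⁿ + 3·(0.925)ⁿ ≤ (0.933)ⁿ`. -/
theorem envelope_le (n : ℕ) (hn : 200 ≤ n) :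
    2 * (0.7072 : ℝ) ^ n + 3 * (0.925 : ℝ) ^ n ≤ (0.933 : ℝ) ^ n := by
  induction n with
  | zero => omega
  | succ m ih =>
    rcases Nat.lt_or_ge m 200 with hm | hm
    · have : m + 1 = 200 := by omega
      rw [this]
      norm_num
    · have h := ih hm
      calc 2 * (0.7072 : ℝ) ^ (m + 1) + 3 * (0.925 : ℝ) ^ (m + 1)
          ≤ 0.925 * (2 * (0.7072 : ℝ) ^ m + 3 * (0.925 : ℝ) ^ m) := by
            rw [pow_succ, pow_succ]; nlinarith [pow_nonneg (by norm_num : (0 : ℝ) ≤ 0.7072) m]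
        _ ≤ 0.925 * (0.933 : ℝ) ^ m := by nlinarith
        _ ≤ (0.933 : ℝ) ^ (m + 1) := by rw [pow_succ]; nlinarith [pow_nonneg (by norm_num : (0 : ℝ) ≤ 0.933) m]

omit [Fintype K] [Algebra (ZMod 2) K] in
/-- `0.933 ≤ 2^{-1/10}`, hence `0.933ⁿ ≤ 2^{-n/10}`. -/
theorem envelope_le_rpow (n : ℕ) : (0.933 : ℝ) ^ n ≤ (2 : ℝ) ^ (-((n : ℝ) / 10)) := by
  have h1 : (0.933 : ℝ) ≤ (2 : ℝ) ^ (-(1 / 10 : ℝ)) := by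
    have h10 : ((2 : ℝ) ^ (-(1 / 10 : ℝ))) ^ 10 = 1 / 2 := by
      rw [← Real.rpow_natCast, ← Real.rpow_mul (by norm_num : (0 : ℝ) ≤ 2)]
      norm_num
    have hpos : (0 : ℝ) ≤ (2 : ℝ) ^ (-(1 / 10 : ℝ)) := Real.rpow_nonneg (by norm_num) _
    by_contra hlt
    push Not at hlt
    have := pow_lt_pow_left₀ hlt hpos (by norm_num : (10 : ℕ) ≠ 0)
    rw [h10] at this
    norm_num at this
  calc (0.933 : ℝ) ^ n ≤ ((2 : ℝ) ^ (-(1 / 10 : ℝ))) ^ n := pow_le_pow_left₀ (by norm_num) h1 n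
    _ = (2 : ℝ) ^ (-((n : ℝ) / 10)) := by
        rw [← Real.rpow_natCast, ← Real.rpow_mul (by norm_num : (0 : ℝ) ≤ 2)]
        congr 1; ring

/-- **THE REAL-TILT / TRACE-ORTHONORMAL CORE**, from the Gold-type Walsh bound `hgold`. -/
theorem coreFlatRealSelfDual_of_gold {n : ℕ} (hn : 200 ≤ n)
    (hK : Fintype.card K = 2 ^ n) (e : K ≃+ (Fin n → ZMod 2))
    (hsd : ∀ x y : K, ∑ i, e x i * e y i = Algebra.trace (ZMod 2) K (x * y))
    (hgold : ∀ {β : K}, β ≠ 0 → ∀ (α : K) (φ : K →+ ZMod 2),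
      |∑ x : K, (if φ x + Algebra.trace (ZMod 2) K (α * x ^ 3 + β * x ^ 5) = 0 then (1 : ℝ) else -1)|
        ≤ 4 * Real.sqrt 2 ^ n)
    (A : Finset (Fin (n + n))) (hA : A.Nonempty) (c s : Fin (n + n) → ℝ) (hcs : ∀ k, c k ^ 2 + s k ^ 2 = 1) :
    ‖star (fun w : QReg (n + n) =>
          if (fun j : Fin n => w (Fin.natAdd n j)) =
              (fun j : Fin n => decide (e ((e.symm (fun i : Fin n => if w (Fin.castAdd n i) then 1 else 0)) ^ 3) j = 1))
          then ((Real.sqrt 2 ^ n)⁻¹ : ℂ) else 0) ⬝ᵥ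
        (tensorAll (fun k => if k ∈ A then
            (Matrix.of fun a b : Bool => if a = b then (if a then -((c k : ℝ) : ℂ) else ((c k : ℝ) : ℂ)) else ((s k : ℝ) : ℂ))
          else (1 : Matrix Bool Bool ℂ))).mulVec
          (fun w : QReg (n + n) =>
            if (fun j : Fin n => w (Fin.natAdd n j)) =
                (fun j : Fin n => decide (e ((e.symm (fun i : Fin n => if w (Fin.castAdd n i) then 1 else 0)) ^ 3) j = 1))
            then ((Real.sqrt 2 ^ n)⁻¹ : ℂ) else 0)‖
      ≤ (2 : ℝ) ^ (-((n : ℝ) / 10)) := by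
  classical
  -- constants
  have hs2 : (0 : ℝ) < Real.sqrt 2 := Real.sqrt_pos.2 (by norm_num)
  have hs2sq : Real.sqrt 2 ^ 2 = 2 := Real.sq_sqrt (by norm_num)
  have hs2lo : (1.4142 : ℝ) ≤ Real.sqrt 2 := by
    rw [show (1.4142 : ℝ) = Real.sqrt (1.4142 ^ 2) from (Real.sqrt_sq (by norm_num)).symm]
    exact Real.sqrt_le_sqrt (by norm_num)
  have hs2hi : Real.sqrt 2 ≤ (1.4143 : ℝ) := by
    rw [show (1.4143 : ℝ) = Real.sqrt (1.4143 ^ 2) from (Real.sqrt_sq (by norm_num)).symm]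
    exact Real.sqrt_le_sqrt (by norm_num)
  set N : ℝ := (2 : ℝ) ^ n with hN
  have hNpos : (0 : ℝ) < N := by positivity
  have hsqN : Real.sqrt 2 ^ n * Real.sqrt 2 ^ n = N := by rw [← mul_pow, Real.mul_self_sqrt (by norm_num : (0:ℝ) ≤ 2)]
  clear_value N
  -- rewrite the expectation through the graph vector and the pair decomposition
  have hop : (fun k => if k ∈ A then
      (Matrix.of fun a b : Bool => if a = b then (if a then -((c k : ℝ) : ℂ) else ((c k : ℝ) : ℂ)) else ((s k : ℝ) : ℂ))
      else (1 : Matrix Bool Bool ℂ)) = siteOp A c s := by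
    funext k; simp only [siteOp, refl]
  rw [normalised_eq_smul e, hop]
  rw [show ((Real.sqrt 2 : ℂ) ^ n)⁻¹ = (((Real.sqrt 2 ^ n)⁻¹ : ℝ) : ℂ) by push_cast; ring]
  rw [star_smul_dot_mulVec_smul, pair_decomposition e A c s, ← Complex.ofReal_mul, Complex.norm_real,
    Real.norm_eq_abs, abs_mul, abs_of_nonneg (by positivity : (0 : ℝ) ≤ ((Real.sqrt 2 ^ n)⁻¹) ^ 2)]
  have hpref : ((Real.sqrt 2 ^ n)⁻¹) ^ 2 = N⁻¹ := by
    rw [inv_pow, ← hsqN, sq]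
  rw [hpref]
  -- abbreviations for the weights
  set cin : Fin n → ℝ := fun i => c (Fin.castAdd n i)
  set sin : Fin n → ℝ := fun i => s (Fin.castAdd n i)
  set cout : Fin n → ℝ := fun j => c (Fin.natAdd n j)
  set sout : Fin n → ℝ := fun j => s (Fin.natAdd n j)
  -- the uniform bound on `|J d|`, `d ≠ 0`
  set κ : ℝ := (1 + Real.sqrt 2) / 2 with hκ
  clear_value κ
  have hκ0 : 0 ≤ κ := by rw [hκ]; positivity
  have hκ1 : 1 ≤ κ := by rw [hκ]; nlinarith
  have hJ : ∀ d : Fin n → Bool, d ≠ (fun _ => false) →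
      |J e A c s d| ≤ Real.sqrt (8 * Real.sqrt 2 ^ n * κ ^ n) := by
    intro d hd
    have ht := J_trivial_bound hK e A c s d hd
    have hf := J_fourier_bound hK e hsd hgold A c s d hd
    have hprod : (∏ j ∈ outSupp A, (|cout j| + |sout j|)) * ∏ j ∈ outSupp A, max |cout j| |sout j| ≤ κ ^ n := by
      rw [← Finset.prod_mul_distrib]
      calc ∏ j ∈ outSupp A, ((|cout j| + |sout j|) * max |cout j| |sout j|)
          ≤ ∏ j ∈ outSupp A, κ := Finset.prod_le_prod (fun j _ => by positivity) fun j _ => by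
              rw [hκ]; exact am_le _ _ (hcs _)
        _ = κ ^ (outSupp A).card := Finset.prod_const _
        _ ≤ κ ^ n := pow_le_pow_right₀ hκ1 (by
            calc (outSupp A).card ≤ (Finset.univ : Finset (Fin n)).card := Finset.card_le_card (Finset.subset_univ _)
              _ = n := by rw [Finset.card_univ, Fintype.card_fin])
    have hJ2 : |J e A c s d| ^ 2 ≤ 8 * Real.sqrt 2 ^ n * κ ^ n := by
      have h0 : 0 ≤ |J e A c s d| := abs_nonneg _
      calc |J e A c s d| ^ 2 = |J e A c s d| * |J e A c s d| := sq _
        _ ≤ (2 * ∏ j ∈ outSupp A, (|cout j| + |sout j|)) *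
              (4 * Real.sqrt 2 ^ n * ∏ j ∈ outSupp A, max |cout j| |sout j|) :=
            mul_le_mul ht hf h0 (by positivity)
        _ = 8 * Real.sqrt 2 ^ n *
              ((∏ j ∈ outSupp A, (|cout j| + |sout j|)) * ∏ j ∈ outSupp A, max |cout j| |sout j|) := by ring
        _ ≤ 8 * Real.sqrt 2 ^ n * κ ^ n := by gcongr
    simpa only [abs_abs] using Real.abs_le_sqrt hJ2
  -- split off the diagonal term and bound the rest
  have hsplit : |∑ d : Fin n → Bool, pw (inSupp A) cin sin d * J e A c s d| ≤
      2 * Real.sqrt 2 ^ n + Real.sqrt 2 ^ n * Real.sqrt (8 * Real.sqrt 2 ^ n * κ ^ n) := by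
    rw [← Finset.add_sum_erase _ _ (Finset.mem_univ (fun _ : Fin n => false))]
    refine (abs_add_le _ _).trans (add_le_add (diag_term_bound hK e A hA c s hcs) ?_)
    calc |∑ d ∈ Finset.univ.erase (fun _ : Fin n => false), pw (inSupp A) cin sin d * J e A c s d|
        ≤ ∑ d ∈ Finset.univ.erase (fun _ : Fin n => false), |pw (inSupp A) cin sin d * J e A c s d| :=
          Finset.abs_sum_le_sum_abs _ _
      _ ≤ ∑ d ∈ Finset.univ.erase (fun _ : Fin n => false),
            |pw (inSupp A) cin sin d| * Real.sqrt (8 * Real.sqrt 2 ^ n * κ ^ n) := by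
          refine Finset.sum_le_sum fun d hd => ?_
          rw [abs_mul]
          exact mul_le_mul_of_nonneg_left (hJ d (Finset.ne_of_mem_erase hd)) (abs_nonneg _)
      _ = (∑ d ∈ Finset.univ.erase (fun _ : Fin n => false), |pw (inSupp A) cin sin d|) *
            Real.sqrt (8 * Real.sqrt 2 ^ n * κ ^ n) := (Finset.sum_mul _ _ _).symm
      _ ≤ Real.sqrt 2 ^ n * Real.sqrt (8 * Real.sqrt 2 ^ n * κ ^ n) := by
          refine mul_le_mul_of_nonneg_right ?_ (Real.sqrt_nonneg _)
          calc ∑ d ∈ Finset.univ.erase (fun _ : Fin n => false), |pw (inSupp A) cin sin d|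
              ≤ ∑ d : Fin n → Bool, |pw (inSupp A) cin sin d| :=
                Finset.sum_le_sum_of_subset_of_nonneg (Finset.erase_subset _ _) fun _ _ _ => abs_nonneg _
            _ ≤ Real.sqrt 2 ^ (inSupp A).card := sum_abs_pw_le _ _ _ fun i _ => hcs _
            _ ≤ Real.sqrt 2 ^ n := pow_le_pow_right₀ (by nlinarith) (by
                calc (inSupp A).card ≤ (Finset.univ : Finset (Fin n)).card := Finset.card_le_card (Finset.subset_univ _)
                  _ = n := by rw [Finset.card_univ, Fintype.card_fin])
  -- numerics: `N⁻¹ (2 √2ⁿ + √2ⁿ √(8 √2ⁿ κⁿ)) ≤ 2·0.7072ⁿ + 3·0.925ⁿ ≤ 0.933ⁿ ≤ 2^{-n/10}`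
  have hterm1 : N⁻¹ * (2 * Real.sqrt 2 ^ n) ≤ 2 * (0.7072 : ℝ) ^ n := by
    -- `N⁻¹ √2ⁿ = (1/√2)ⁿ ≤ 0.7072ⁿ`
    have hinv : N⁻¹ * Real.sqrt 2 ^ n = (Real.sqrt 2)⁻¹ ^ n := by
      rw [← hsqN, mul_inv, inv_pow, mul_assoc, inv_mul_cancel₀ (pow_ne_zero _ hs2.ne'), mul_one]
    have hle : (Real.sqrt 2)⁻¹ ≤ 0.7072 := by
      rw [inv_le_comm₀ hs2 (by norm_num)]
      calc (0.7072 : ℝ)⁻¹ ≤ 1.4142 := by norm_num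
        _ ≤ Real.sqrt 2 := hs2lo
    calc N⁻¹ * (2 * Real.sqrt 2 ^ n) = 2 * (N⁻¹ * Real.sqrt 2 ^ n) := by ring
      _ = 2 * (Real.sqrt 2)⁻¹ ^ n := by rw [hinv]
      _ ≤ 2 * (0.7072 : ℝ) ^ n := by
          gcongr
  have hterm2 : N⁻¹ * (Real.sqrt 2 ^ n * Real.sqrt (8 * Real.sqrt 2 ^ n * κ ^ n)) ≤ 3 * (0.925 : ℝ) ^ n := by
    -- square both sides: `(N⁻¹ √2ⁿ)² · 8 √2ⁿ κⁿ = 8 (κ/√2)ⁿ / … ` ; we use `κ/√2 ≤ 0.925²`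
    have hratio : κ / Real.sqrt 2 ≤ (0.925 : ℝ) ^ 2 := by
      rw [div_le_iff₀ hs2, hκ]
      nlinarith
    have hQ : (0 : ℝ) ≤ 8 * Real.sqrt 2 ^ n * κ ^ n := by positivity
    have hs2n : Real.sqrt 2 ^ n ≠ 0 := pow_ne_zero _ hs2.ne'
    have hL : N⁻¹ * (Real.sqrt 2 ^ n * Real.sqrt (8 * Real.sqrt 2 ^ n * κ ^ n)) =
        Real.sqrt (8 * Real.sqrt 2 ^ n * κ ^ n) / Real.sqrt 2 ^ n := by
      rw [← hsqN]
      field_simp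
    have hsq : (Real.sqrt (8 * Real.sqrt 2 ^ n * κ ^ n) / Real.sqrt 2 ^ n) ^ 2 = 8 * (κ / Real.sqrt 2) ^ n := by
      rw [div_pow, Real.sq_sqrt hQ, div_pow]
      field_simp
    have hrhs : 8 * (κ / Real.sqrt 2) ^ n ≤ (3 * (0.925 : ℝ) ^ n) ^ 2 := by
      calc 8 * (κ / Real.sqrt 2) ^ n ≤ 8 * ((0.925 : ℝ) ^ 2) ^ n := by
            gcongr
        _ = 8 * ((0.925 : ℝ) ^ n) ^ 2 := by rw [← pow_mul, mul_comm 2 n, pow_mul]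
        _ ≤ (3 * (0.925 : ℝ) ^ n) ^ 2 := by nlinarith [pow_nonneg (by norm_num : (0:ℝ) ≤ 0.925) n]
    rw [hL]
    rw [← hsq] at hrhs
    exact (abs_le_of_sq_le_sq' hrhs (by positivity)).2
  calc N⁻¹ * |∑ d : Fin n → Bool, pw (inSupp A) cin sin d * J e A c s d|
      ≤ N⁻¹ * (2 * Real.sqrt 2 ^ n + Real.sqrt 2 ^ n * Real.sqrt (8 * Real.sqrt 2 ^ n * κ ^ n)) :=
        mul_le_mul_of_nonneg_left hsplit (inv_nonneg.2 hNpos.le)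
    _ = N⁻¹ * (2 * Real.sqrt 2 ^ n) + N⁻¹ * (Real.sqrt 2 ^ n * Real.sqrt (8 * Real.sqrt 2 ^ n * κ ^ n)) := by ring
    _ ≤ 2 * (0.7072 : ℝ) ^ n + 3 * (0.925 : ℝ) ^ n := add_le_add hterm1 hterm2
    _ ≤ (0.933 : ℝ) ^ n := envelope_le n hn
    _ ≤ (2 : ℝ) ^ (-((n : ℝ) / 10)) := envelope_le_rpow n


end Statements

end CoreReal

/-- **`stub_coreFlatRealSelfDual`** (registered sub-goal of crux stmt-QuantumAdvantage-0242, line Sketch): the provable slice of the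
open core stub — all supports, real tilts, trace-orthonormal coordinates, rate `2^{-n/10}` from `n₀ = 200`. -/
theorem stub_coreFlatRealSelfDual : ∃ n₀ : ℕ, ∀ n ≥ n₀, ∀ (K : Type) [Field K] [Fintype K] [Algebra (ZMod 2) K],
    Fintype.card K = 2 ^ n → ∀ e : K ≃+ (Fin n → ZMod 2),
    (∀ x y : K, ∑ i, e x i * e y i = Algebra.trace (ZMod 2) K (x * y)) →
    ∀ A : Finset (Fin (n + n)), A.Nonempty → ∀ c s : Fin (n + n) → ℝ, (∀ k, c k ^ 2 + s k ^ 2 = 1) →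
      ‖star (fun w : Literature.Computability.Cryptography.QReg (n + n) =>
            if (fun j : Fin n => w (Fin.natAdd n j)) =
                (fun j : Fin n => decide (e ((e.symm (fun i : Fin n => if w (Fin.castAdd n i) then 1 else 0)) ^ 3) j = 1))
            then ((Real.sqrt 2 ^ n)⁻¹ : ℂ) else 0) ⬝ᵥ
          (Literature.Computability.QuantumComplexity.tensorAll (fun k => if k ∈ A then
              (Matrix.of fun a b : Bool => if a = b then (if a then -((c k : ℝ) : ℂ) else ((c k : ℝ) : ℂ)) else ((s k : ℝ) : ℂ))
            else (1 : Matrix Bool Bool ℂ))).mulVec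
            (fun w : Literature.Computability.Cryptography.QReg (n + n) =>
              if (fun j : Fin n => w (Fin.natAdd n j)) =
                  (fun j : Fin n => decide (e ((e.symm (fun i : Fin n => if w (Fin.castAdd n i) then 1 else 0)) ^ 3) j = 1))
              then ((Real.sqrt 2 ^ n)⁻¹ : ℂ) else 0)‖
        ≤ (2 : ℝ) ^ (-((n : ℝ) / 10)) :=
  ⟨200, fun _ hn _ _ _ _ hK e hsd A hA c s hcs =>
    CoreReal.coreFlatRealSelfDual_of_gold hn hK e hsd (fun hβ α φ => GoldWalsh.abs_walsh_gold_add_le hK hβ α φ) A hA c s hcs⟩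

end Summit.QuantumAdvantage.QuantumAdvantage.Theorems.SymplecticPurity

end
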